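import Summits.Ventures.MM22.Rank333.Wang333LPData1
import Summits.Ventures.MM22.Rank333.Wang333LPAssembly
import Summits.Ventures.MM22.Rank333.Wang333LPDfs1
import Summits.Ventures.MM22.Rank333.Wang333LPDfs6
import Summits.Ventures.MM22.Rank333.Wang333LPDfs7
import Summits.Ventures.MM22.Rank333.Wang333LPDfs8
import HarnessLib

/-!
# MM22 venture, Route D3-STRETCH — `⟨3,3,3⟩/𝔽₂` LP certificate chain (dims 2–9): LP-DFS DATA 9

HONEST FRAMING (cell `pub-mm22`, seat p3, Route D3-STRETCH). Part of a kernel certificate chain for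
`20 ≤ R_{𝔽₂}(⟨3,3,3⟩)` built from Wang's orbit table (arXiv:2603.07280, `cert_matrix_q02_n333`: 496 orbits of constraint
subspaces of the first factor under `GL₃ × GL₃ ⋊ C₂`) with NEW, much smaller justifications: p2's integer
'fractional substitution' LP certificates (HOME/pub-mm22-p2/routeD/lpcert_333_int.json; the LP rule is LIT-2's
`Literature/…/SubstitutionLPBound.lean` + `SubstitutionLPBacktracking.lean`, the checker `GF2OrbitSweepLP.lean`) for 444 orbits
of dimensions 2–7, Wang's own flattenings (11) and forced products (14, two of them through the transpose twin) for the rest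
of dimensions 5–9, explicit sandwich / transposed-sandwich lookups validated by the pull-back check (`GF2FastSandwich.lean`).
23 backtracking orbits of dimensions 2–5 are HYPOTHESES in this chain (their LP-DFS certificates are p2's gate G1, pending);
dimensions 0–1 are the already landed top layer (`WangTop333*.lean`). So the end theorem of this chain is CONDITIONAL on 23
explicit orbit claims; nothing here asserts `RankGe20F2` unconditionally.

This file: LP-DFS rounds (p2's LPDFS certificates, HOME/pub-mm22-p2/routeD/lpdfs/, gate G1 = PASS on three checkers): per orbit the
distinct superspace masks `uT_i`, the two lookup tables, the mask-LP trees (`MLI`/`MN`) per DFS root, the root family and the two steps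
`st1_i` (plain LP at target − 1) / `st2_i` (the LP-DFS round at the target).
-/

set_option Elab.async false
set_option maxRecDepth 100000

namespace Summit.Ventures.MM22.GF2Cert.LP333

open Summit.MatrixMultiplication.OmegaCensus.GF2RankLB Literature.Computability.AlgebraicComplexity
open Summit.Ventures.MM22.GF2Cert

/-- LP-DFS root family of orbit 429. -/
noncomputable def rt_429 : Fin 63 → MCert 63 := fun mm => [m429_0, m429_1, m429_2, m429_3, m429_4, m429_5, m429_6, m429_7, m429_8, m429_9, m429_10, m429_11, m429_12, m429_13, m429_14, m429_15, m429_16, m429_17, m429_18, m429_19, m429_20, m429_21, m429_22, m429_23, m429_24, m429_25, m429_26, m429_27, m429_28, m429_29, m429_30, m429_31, m429_32, m429_33, m429_34, m429_35, m429_36, m429_37, m429_38, m429_39, m429_40, m429_41, m429_42, m429_43, m429_44, m429_45, m429_46, m429_47, m429_48, m429_49, m429_50, m429_51, m429_52, m429_53, m429_54, m429_55, m429_56, m429_57, m429_58, m429_59, m429_60, m429_61, m429_62].getD mm.val (ML 63 [] 1)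
set_option maxRecDepth 100000 in
/-- LP-DFS round of orbit 429 (target 17; 1109 LP leaves). -/
noncomputable def st2_429 : StepX := .dfsLP cp49 17 2 3 0 tb2_429 tt2_429 rt_429
end Summit.Ventures.MM22.GF2Cert.LP333
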